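import Summits.ValiantsHypothesis.ValiantsHypothesis.Theorems.AnyonJetsResummation
import HarnessLib

/-!
# Route `AnyonJets`, crux `UniformJetUpperBound` (stmt-ValiantsHypothesis-16739) — registered stub
# `stub_jetTaylor` (line `birth`): the jets are the Taylor coefficients of the pencil at the fermion point

With `u = q + 1`, the shifted inversion pencil

  `F_n(u; X) = P_n(u - 1; X) = ∑_σ (u - 1)^{inv σ} ∏ᵢ X_{σ i, i}`   (variables `Option (Fin n × Fin n)`, `u = X none`)

has `u`-degree `≤ n(n-1)/2` (`inv σ ≤ n(n-1)/2`, `card_inversions_le`) and, for every `k`,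

  `J_{n,k} ⊗ ℂ = (-1)^k · [u^k] F_n`,   `J_{n,k} = ∑_σ sgn σ · binom(inv σ, k) · ∏ᵢ X_{σ i, i}`:

indeed `[u^k] (u-1)^I = (-1)^{I-k} binom(I, k)` (`Polynomial.coeff_X_add_C_pow`) and
`sgn σ = (-1)^{inv σ}` (tree: `Pfaffian.cast_sign_eq_neg_one_pow`), so
`(-1)^k (-1)^{I-k} binom(I,k) = sgn σ · binom(I,k)` for `k ≤ I`, both sides vanishing for `k > I`.
Proved over every commutative ring `K` (`natDegree_shiftedPencil_le`, `coeff_shiftedPencil`,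
`map_jet_eq_smul_coeff`), then restated VERBATIM as the registered stub `stub_jetTaylor` (`K = ℂ`).
HONEST FRAMING: an elementary generating-function identity serving a dormant route; nothing here
bears on `VP ≠ VNP`.

References: L. G. Valiant, *Completeness classes in algebra*, STOC 1979 (the jets of the route);
A. Björner, F. Brenti, *Combinatorics of Coxeter Groups*, Springer 2005, Prop. 1.5.2 (inversions and
sign); P. Bürgisser, *Completeness and Reduction in Algebraic Complexity Theory*, 2000, §2.1.
-/

noncomputable section

-- single-conjunct layout: Sub = Summit, duplicated namespace component intended
set_option linter.dupNamespace false

namespace Summit.ValiantsHypothesis.ValiantsHypothesis.Theorems.AnyonJets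

namespace UniformJet

open MvPolynomial Literature.Combinatorics.Enumerative Finset

section Taylor

variable (K : Type*) [CommRing K] (n : ℕ)

/-- **The shifted pencil as a univariate polynomial in `u` over `K[X_{ij}]`**:
`F_n = ∑_σ (u - 1)^{inv σ} · C(∏ᵢ X_{σ i, i})`. [folklore] -/
theorem optionEquivLeft_shiftedPencil :
    optionEquivLeft K (Fin n × Fin n) (∑ σ : Equiv.Perm (Fin n),
        ((X none : MvPolynomial (Option (Fin n × Fin n)) K) - 1) ^
            (univ.filter (fun p : Fin n × Fin n => p.1 < p.2 ∧ σ p.2 < σ p.1)).card *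
          ∏ i : Fin n, X (some (σ i, i))) =
      ∑ σ : Equiv.Perm (Fin n), (Polynomial.X - 1) ^
            (univ.filter (fun p : Fin n × Fin n => p.1 < p.2 ∧ σ p.2 < σ p.1)).card *
          Polynomial.C (∏ i : Fin n, (X (σ i, i) : MvPolynomial (Fin n × Fin n) K)) := by
  simp only [map_sum, map_mul, map_pow, map_prod, map_sub, map_one, optionEquivLeft_X_none,
    optionEquivLeft_X_some]

/-- **The shifted pencil has `u`-degree `≤ n(n-1)/2`** (`inv σ ≤ n(n-1)/2`). [folklore] -/
theorem natDegree_shiftedPencil_le :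
    (optionEquivLeft K (Fin n × Fin n) (∑ σ : Equiv.Perm (Fin n),
        ((X none : MvPolynomial (Option (Fin n × Fin n)) K) - 1) ^
            (univ.filter (fun p : Fin n × Fin n => p.1 < p.2 ∧ σ p.2 < σ p.1)).card *
          ∏ i : Fin n, X (some (σ i, i)))).natDegree ≤ n * (n - 1) / 2 := by
  rw [optionEquivLeft_shiftedPencil]
  refine Polynomial.natDegree_sum_le_of_forall_le _ _ fun σ _ => ?_
  refine Polynomial.natDegree_mul_le.trans ?_
  rw [Polynomial.natDegree_C, add_zero]
  refine Polynomial.natDegree_pow_le.trans ?_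
  have h1 : (Polynomial.X - 1 : Polynomial (MvPolynomial (Fin n × Fin n) K)).natDegree ≤ 1 :=
    (Polynomial.natDegree_sub_le _ _).trans
      (max_le Polynomial.natDegree_X_le (by rw [Polynomial.natDegree_one]; exact Nat.zero_le _))
  exact (Nat.mul_le_mul (card_inversions_le σ) h1).trans (le_of_eq (mul_one _))

/-- `[u^k] (u - 1)^I = (-1)^{I-k} binom(I, k)`. [folklore] -/
theorem coeff_X_sub_one_pow (R : Type*) [CommRing R] (I k : ℕ) :
    ((Polynomial.X - 1 : Polynomial R) ^ I).coeff k = (-1 : R) ^ (I - k) * (I.choose k : R) := by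
  have h : (Polynomial.X - 1 : Polynomial R) = Polynomial.X + Polynomial.C (-1) := by
    rw [map_neg, map_one, sub_eq_add_neg]
  rw [h, Polynomial.coeff_X_add_C_pow]

/-- **The `u^k`-coefficient of the shifted pencil**:
`[u^k] F_n = ∑_σ (-1)^{inv σ - k} binom(inv σ, k) ∏ᵢ X_{σ i, i}`. [folklore] -/
theorem coeff_shiftedPencil (k : ℕ) :
    (optionEquivLeft K (Fin n × Fin n) (∑ σ : Equiv.Perm (Fin n),
        ((X none : MvPolynomial (Option (Fin n × Fin n)) K) - 1) ^
            (univ.filter (fun p : Fin n × Fin n => p.1 < p.2 ∧ σ p.2 < σ p.1)).card *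
          ∏ i : Fin n, X (some (σ i, i)))).coeff k =
      ∑ σ : Equiv.Perm (Fin n),
        C ((-1 : K) ^ ((univ.filter (fun p : Fin n × Fin n => p.1 < p.2 ∧ σ p.2 < σ p.1)).card - k) *
            (((univ.filter (fun p : Fin n × Fin n => p.1 < p.2 ∧ σ p.2 < σ p.1)).card.choose k : ℕ) : K)) *
          ∏ i : Fin n, X (σ i, i) := by
  rw [optionEquivLeft_shiftedPencil, Polynomial.finsetSum_coeff]
  refine Finset.sum_congr rfl fun σ _ => ?_
  rw [Polynomial.coeff_mul_C, coeff_X_sub_one_pow, map_mul, map_pow, map_neg, map_one, map_natCast]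

/-- **Sign bookkeeping**: `sgn σ · binom(inv σ, k) = (-1)^k · (-1)^{inv σ - k} binom(inv σ, k)`
(`sgn σ = (-1)^{inv σ}`, `Pfaffian.cast_sign_eq_neg_one_pow`; both sides vanish for `k > inv σ`).
[folklore] -/
theorem sign_mul_choose (σ : Equiv.Perm (Fin n)) (k : ℕ) :
    ((Equiv.Perm.sign σ : ℤ) : K) *
        (((univ.filter (fun p : Fin n × Fin n => p.1 < p.2 ∧ σ p.2 < σ p.1)).card.choose k : ℕ) : K) =
      (-1 : K) ^ k *
        ((-1 : K) ^ ((univ.filter (fun p : Fin n × Fin n => p.1 < p.2 ∧ σ p.2 < σ p.1)).card - k) *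
          (((univ.filter (fun p : Fin n × Fin n => p.1 < p.2 ∧ σ p.2 < σ p.1)).card.choose k : ℕ) : K)) := by
  have hs : ((Equiv.Perm.sign σ : ℤ) : K) =
      (-1 : K) ^ (univ.filter (fun p : Fin n × Fin n => p.1 < p.2 ∧ σ p.2 < σ p.1)).card :=
    Pfaffian.cast_sign_eq_neg_one_pow σ
  rw [hs]
  by_cases hk : k ≤ (univ.filter (fun p : Fin n × Fin n => p.1 < p.2 ∧ σ p.2 < σ p.1)).card
  · rw [← mul_assoc, ← pow_add, Nat.add_sub_cancel' hk]
  · rw [Nat.choose_eq_zero_of_lt (not_le.1 hk), Nat.cast_zero, mul_zero, mul_zero, mul_zero]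

/-- **The jets are `±` the Taylor coefficients**: `J_{n,k} ⊗ K = (-1)^k · [u^k] F_n` for every `k`
(mapping the integer polynomial `J_{n,k}` to `K`). [folklore] -/
theorem map_jet_eq_smul_coeff (k : ℕ) :
    MvPolynomial.map (Int.castRingHom K)
        (∑ σ : Equiv.Perm (Fin n), MvPolynomial.C (((Equiv.Perm.sign σ : ℤˣ) : ℤ) *
            (((univ.filter (fun p : Fin n × Fin n => p.1 < p.2 ∧ σ p.2 < σ p.1)).card.choose k : ℕ) : ℤ)) *
          ∏ i : Fin n, MvPolynomial.X (σ i, i) : MvPolynomial (Fin n × Fin n) ℤ) =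
      (-1 : K) ^ k •
        (optionEquivLeft K (Fin n × Fin n) (∑ σ : Equiv.Perm (Fin n),
          ((X none : MvPolynomial (Option (Fin n × Fin n)) K) - 1) ^
              (univ.filter (fun p : Fin n × Fin n => p.1 < p.2 ∧ σ p.2 < σ p.1)).card *
            ∏ i : Fin n, X (some (σ i, i)))).coeff k := by
  rw [coeff_shiftedPencil, Finset.smul_sum, map_sum]
  refine Finset.sum_congr rfl fun σ _ => ?_
  rw [map_mul (MvPolynomial.map (Int.castRingHom K)) (C _) _, map_C, map_prod]
  simp only [map_X, eq_intCast, Int.cast_mul, Int.cast_natCast]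
  rw [sign_mul_choose, smul_eq_C_mul]
  simp only [map_mul]
  ring

end Taylor

end UniformJet

/-- **Registered stub `stub_jetTaylor`** (crux stmt-ValiantsHypothesis-16739, line `birth`; verbatim
signature): the shifted inversion pencil `F_n = ∑_σ (X none - 1)^{inv σ} ∏ᵢ X (some (σ i, i))` has
`u`-degree `≤ n(n-1)/2` and `J_{n,k} ⊗ ℂ = (-1)^k · [u^k] F_n` for every `k`
(`UniformJet.natDegree_shiftedPencil_le`, `UniformJet.map_jet_eq_smul_coeff` at `K = ℂ`).
[folklore] -/
theorem stub_jetTaylor :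
    ∀ n : ℕ,
      (MvPolynomial.optionEquivLeft ℂ (Fin n × Fin n)
          (∑ σ : Equiv.Perm (Fin n),
            ((MvPolynomial.X none : MvPolynomial (Option (Fin n × Fin n)) ℂ) - 1) ^
                (Finset.univ.filter (fun p : Fin n × Fin n => p.1 < p.2 ∧ σ p.2 < σ p.1)).card *
              ∏ i : Fin n, MvPolynomial.X (some (σ i, i)))).natDegree ≤ n * (n - 1) / 2 ∧
      ∀ k : ℕ,
        MvPolynomial.map (Int.castRingHom ℂ)
            (∑ σ : Equiv.Perm (Fin n), MvPolynomial.C (((Equiv.Perm.sign σ : ℤˣ) : ℤ) *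
                (((Finset.univ.filter (fun p : Fin n × Fin n => p.1 < p.2 ∧ σ p.2 < σ p.1)).card.choose k : ℕ) : ℤ)) *
              ∏ i : Fin n, MvPolynomial.X (σ i, i) : MvPolynomial (Fin n × Fin n) ℤ) =
          (-1 : ℂ) ^ k •
            (MvPolynomial.optionEquivLeft ℂ (Fin n × Fin n)
              (∑ σ : Equiv.Perm (Fin n),
                ((MvPolynomial.X none : MvPolynomial (Option (Fin n × Fin n)) ℂ) - 1) ^
                    (Finset.univ.filter (fun p : Fin n × Fin n => p.1 < p.2 ∧ σ p.2 < σ p.1)).card *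
                  ∏ i : Fin n, MvPolynomial.X (some (σ i, i)))).coeff k :=
  fun n => ⟨UniformJet.natDegree_shiftedPencil_le ℂ n, fun k => UniformJet.map_jet_eq_smul_coeff ℂ n k⟩

end Summit.ValiantsHypothesis.ValiantsHypothesis.Theorems.AnyonJets

end
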